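import Summits.HubbardSuperconductivity.HubbardSuperconductivity.Theses.FunctionFieldCertificate
import HarnessLib

/-!
# Crux `MesoscopicPairOrder` (item `stmt-HubbardSuperconductivity-7331`), line `SketchIdeator4` —
# stub `stub_cornerWindow` (the η-corner: strict pair chemical potential below `U`)

Helper file (lands `--supports stmt-HubbardSuperconductivity-7331`; the composition lives in the
lead's skeleton `Cruxes/MesoscopicPairOrder/Lines/SketchIdeator4.lean`, route
`FunctionFieldCertificate`). Objects: the pure Hubbard Hamiltonian `H = hubbardTorus 2 L 1 U` on the
fermionic torus `(ℤ/Lℤ)²` and the sector energies `E(N, 0) = H.minEnergyOn (szSector N 0)`; both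
sector energies stay opaque real numbers here.

* `stub_cornerWindow` — the registered stub: GIVEN the density-weighted pair addition bound
  `E(2n+2, 0) ≤ E(2n, 0) + (8n + U(2n+1))/(L² - n)` (`U ≥ 0`, `2n + 2 ≤ L²`; the signature of the
  neighbour stub `stub_pairAdditionBound`, taken verbatim as a hypothesis), for `δ ∈ (1/3, 1/2)` and
  `U > 8(1-δ)/(3δ-1)` there is `L₀` (namely `L₀ = 2`) such that for all `L ≥ L₀` the half pair
  number `⌊(1-δ)L²/2⌋` is some `n + 1 ≥ 1`, `2n + 2 ≤ L²`, and `E(2n+2, 0) < E(2n, 0) + U`.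
  Real arithmetic: with `ν = (1-δ)L²/2 ≥ 1` and `n + 1 = ⌊ν⌋ ≤ ν`, the numerator satisfies
  `8n + U(2n+1) + Un ≤ (8 + 3U)(ν - 1) + U < (8 + 3U)ν`, and `(8 + 3U)ν ≤ U L²` is
  `(8 + 3U)(1-δ) ≤ 2U`, i.e. `8(1-δ) ≤ U(3δ-1)`, which is the corner condition; the denominator
  `L² - n ≥ L² - ν + 1 > 0`.

No definition is introduced. H. Tasaki, *Physics and Mathematics of Quantum Many-Body Systems*
(2020) §2.1 (the variational setting); the computation is folklore.
-/

noncomputable section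

-- the summit namespace repeats the problem name by design (D-0017)
set_option linter.dupNamespace false

namespace Summit.HubbardSuperconductivity.HubbardSuperconductivity.Theorems.FunctionFieldCertificate

open Matrix Finset
open Literature.Probability.LatticeModels Literature.MathematicalPhysics.QuantumLattice
open scoped ComplexOrder

/-- **Stub `stub_cornerWindow`** (real arithmetic in the η-corner). GIVEN the pair addition bound
`E(2n+2, 0) ≤ E(2n, 0) + (8n + U(2n+1))/(L² - n)` for `U ≥ 0`, `2n + 2 ≤ L²` (the signature of
`stub_pairAdditionBound`, verbatim, as a hypothesis), for `δ ∈ (1/3, 1/2)` and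
`U > 8(1-δ)/(3δ-1)` (so `U > 0`) there is `L₀` such that for every `L ≥ L₀`: the half pair number
`⌊(1-δ)L²/2⌋` is some `n + 1 ≥ 1`, `2n + 2 ≤ L²`, and the pair chemical potential is strictly
below `U`: `E(2n+2, 0) < E(2n, 0) + U`. (Take `L₀ = 2`; with `n + 1 ≤ ν = (1-δ)L²/2` one has
`8n + U(2n+1) + Un ≤ (8 + 3U)(ν - 1) + U < (8 + 3U)ν ≤ U L²` because `8(1-δ) < U(3δ-1)`, and
`L² - n > 0`.) [folklore]; cf. Tasaki (2020) §2.1. -/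
theorem stub_cornerWindow :
    (∀ (U : ℝ), 0 ≤ U → ∀ (L : ℕ) [NeZero L] (n : ℕ), 2 * n + 2 ≤ L ^ 2 →
      (hubbardTorus 2 L 1 U).minEnergyOn (szSector (2 * (n + 1)) 0) ≤
        (hubbardTorus 2 L 1 U).minEnergyOn (szSector (2 * n) 0) +
          (8 * n + U * (2 * n + 1)) / ((L : ℝ) ^ 2 - n)) →
    ∀ U δ : ℝ, δ ∈ Set.Ioo (1 / 3 : ℝ) (1 / 2) → 8 * (1 - δ) / (3 * δ - 1) < U →
      ∃ L₀ : ℕ, ∀ (L : ℕ) [NeZero L], L₀ ≤ L →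
        ∃ n : ℕ, ⌊(1 - δ) * (L : ℝ) ^ 2 / 2⌋₊ = n + 1 ∧ 2 * n + 2 ≤ L ^ 2 ∧
          (hubbardTorus 2 L 1 U).minEnergyOn (szSector (2 * (n + 1)) 0) <
            (hubbardTorus 2 L 1 U).minEnergyOn (szSector (2 * n) 0) + U := by
  intro hadd U δ hδ hU
  obtain ⟨hδ₁, hδ₂⟩ := hδ
  have h3δ : 0 < 3 * δ - 1 := by linarith
  -- the corner condition, cleared of its denominator, and `U > 0`
  have hU8 : 8 * (1 - δ) < U * (3 * δ - 1) := (div_lt_iff₀ h3δ).mp hU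
  have hUpos : 0 < U := (div_pos (by linarith) h3δ).trans hU
  refine ⟨2, ?_⟩
  intro L _ hL
  -- the real parameters `L² ≥ 4` and `ν = (1-δ)L²/2 ≥ 1`
  have hL2 : (2 : ℝ) ≤ (L : ℝ) := by exact_mod_cast hL
  have hS4 : (4 : ℝ) ≤ (L : ℝ) ^ 2 := by nlinarith
  have hδS : 0 < δ * (L : ℝ) ^ 2 := mul_pos (by linarith) (by linarith)
  have hν1 : 1 ≤ (1 - δ) * (L : ℝ) ^ 2 / 2 := by
    nlinarith [mul_nonneg (sub_nonneg.mpr hδ₂.le) (sub_nonneg.mpr hS4)]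
  have hν0 : (0 : ℝ) ≤ (1 - δ) * (L : ℝ) ^ 2 / 2 := zero_le_one.trans hν1
  -- `n + 1 := ⌊ν⌋₊ ≥ 1`
  have hk : 1 ≤ ⌊(1 - δ) * (L : ℝ) ^ 2 / 2⌋₊ := (Nat.one_le_floor_iff _).mpr hν1
  obtain ⟨n, hn⟩ : ∃ n : ℕ, ⌊(1 - δ) * (L : ℝ) ^ 2 / 2⌋₊ = n + 1 :=
    ⟨⌊(1 - δ) * (L : ℝ) ^ 2 / 2⌋₊ - 1, by omega⟩
  have hnν : (n : ℝ) + 1 ≤ (1 - δ) * (L : ℝ) ^ 2 / 2 := by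
    have h := Nat.floor_le hν0
    rw [hn] at h
    exact_mod_cast h
  -- `2n + 2 ≤ 2ν = (1-δ)L² ≤ L²`
  have h2n : 2 * n + 2 ≤ L ^ 2 := by
    have h : 2 * (n : ℝ) + 2 ≤ (L : ℝ) ^ 2 := by linarith
    exact_mod_cast h
  refine ⟨n, hn, h2n, ?_⟩
  -- the addition bound at `(U, L, n)` and the increment `< U`
  have hbound := hadd U hUpos.le L n h2n
  have hden : (0 : ℝ) < (L : ℝ) ^ 2 - n := by linarith
  have hfrac : (8 * n + U * (2 * n + 1)) / ((L : ℝ) ^ 2 - n) < U := by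
    rw [div_lt_iff₀ hden]
    have h1 : (8 + 3 * U) * ((n : ℝ) + 1) ≤ (8 + 3 * U) * ((1 - δ) * (L : ℝ) ^ 2 / 2) :=
      mul_le_mul_of_nonneg_left hnν (by positivity)
    have h2 : 8 * (1 - δ) * (L : ℝ) ^ 2 < U * (3 * δ - 1) * (L : ℝ) ^ 2 :=
      mul_lt_mul_of_pos_right hU8 (by linarith)
    linarith
  linarith

end Summit.HubbardSuperconductivity.HubbardSuperconductivity.Theorems.FunctionFieldCertificate
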